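import Summits.BirchSwinnertonDyer.BirchSwinnertonDyer.Theses.KatoDescentPotSupersingular
import Literature.NumberTheory.EllipticCurves.AnalyticRankBCDTProofs
import HarnessLib

/-!
# Route `KatoDescentPotSupersingular` (rung K9, cell `bsd-potss`): the held input «`L(E,s)` entire» IS IMPLIED BY the held
# input «modularity» — the four `…EntireLFunction…` alias items of the route, each from the route's `exists_isNewformOf`
# alias, by the tree's Hecke road (a `--supports 19190 --as helper` file; seat `bsd-potss-k9-red9` g3; CONDITIONAL results —
# no item is closed by this file; nothing booked, BSD is not proved by any of this)

WHY.  Crux 19190 `WildUpperReducibleDefect` (U₀-red) is SPLIT into six HELD cite-level inputs + glue; two of them are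
`PublishedInputNewformKatoRed := exists_isNewformOf` (item 19701, the Modularity Theorem, Version L) and
`PublishedInputEntireLFunctionRed := hasEntireLFunction_rat` (item 19710).  The second is NOT an independent input: the
tree proves `WeierstrassCurve.hasEntireLFunction_rat_of_exists_isNewformOf` (Diamond–Shurman Thm. 8.8.3 with Hecke's
Thm. 5.10.2; `AnalyticRankModularityProofs`).  The same holds for the other three aliases of `hasEntireLFunction_rat` in the
route (`PublishedInputEntireLFunction`, child of 19564 / 19198; `PublishedInputEntireLFunctionW`, child of 19195;
`PublishedInputEntireLFunctionNamed`, child of 19532) against `PublishedInputNewformKato` (child of 19196).  This file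
records the four implications BY NAME, so that a planner re-glue may drop the `…EntireLFunction…` children (trust base of
U₀-red / M / L₀ / the O6 bundle: one named input fewer), and so that any assembly holding modularity gets entireness free.

HONEST FRAMING.  Conditional one-liners over a landed Literature theorem; they close nothing (an alias item closes only on
its own signature); modularity itself stays a named input (BCDT Thm. A).  THEOREMS ONLY (no definition, no new fact, no
`sorry`).

References: [DiamondShurman2005] Thm. 5.10.2, Thm. 8.8.3; [BCDTJAMS2001] Thm. A; [Kato2004Asterisque] (context only).
-/

set_option autoImplicit false
-- sibling precedent (`KatoDescentPotSupersingularAssembly.lean`): the directory name repeats the summit name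
set_option linter.dupNamespace false

noncomputable section

namespace Summit.BirchSwinnertonDyer.BirchSwinnertonDyer.Theorems.PublishedInputEntireLFunctionOfNewform

open Summit.BirchSwinnertonDyer.BirchSwinnertonDyer.Theses.KatoDescentPotSupersingular

/-- **Item 19710 from item 19701**: `PublishedInputNewformKatoRed → PublishedInputEntireLFunctionRed` (modularity, Version L
⟹ `L(E, s)` entire, by Hecke; tree `hasEntireLFunction_rat_of_exists_isNewformOf`). Conditional; closes nothing.
[cite: DiamondShurman2005, Thm. 8.8.3 with Thm. 5.10.2] -/
theorem publishedInputEntireLFunctionRed_of_newformKatoRed (h : PublishedInputNewformKatoRed) :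
    PublishedInputEntireLFunctionRed :=
  WeierstrassCurve.hasEntireLFunction_rat_of_exists_isNewformOf h

/-- **`PublishedInputNewformKato → PublishedInputEntireLFunction`** (children of 19196 resp. 19564 / 19198): the same Hecke
road. Conditional; closes nothing. [cite: DiamondShurman2005, Thm. 8.8.3 with Thm. 5.10.2] -/
theorem publishedInputEntireLFunction_of_newformKato (h : PublishedInputNewformKato) : PublishedInputEntireLFunction :=
  WeierstrassCurve.hasEntireLFunction_rat_of_exists_isNewformOf h

/-- **`PublishedInputNewformKato → PublishedInputEntireLFunctionW`** (the L₀ split's alias, child of 19195).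
Conditional; closes nothing. [cite: DiamondShurman2005, Thm. 8.8.3 with Thm. 5.10.2] -/
theorem publishedInputEntireLFunctionW_of_newformKato (h : PublishedInputNewformKato) : PublishedInputEntireLFunctionW :=
  WeierstrassCurve.hasEntireLFunction_rat_of_exists_isNewformOf h

/-- **`PublishedInputNewformKato → PublishedInputEntireLFunctionNamed`** (the by-name bundle's alias, child of 19532).
Conditional; closes nothing. [cite: DiamondShurman2005, Thm. 8.8.3 with Thm. 5.10.2] -/
theorem publishedInputEntireLFunctionNamed_of_newformKato (h : PublishedInputNewformKato) :
    PublishedInputEntireLFunctionNamed :=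
  WeierstrassCurve.hasEntireLFunction_rat_of_exists_isNewformOf h

/-- The two modularity aliases of the route agree (`PublishedInputNewformKatoRed ↔ PublishedInputNewformKato`, both
`exists_isNewformOf`). Bookkeeping. [folklore] -/
theorem publishedInputNewformKatoRed_iff : PublishedInputNewformKatoRed ↔ PublishedInputNewformKato := Iff.rfl

end Summit.BirchSwinnertonDyer.BirchSwinnertonDyer.Theorems.PublishedInputEntireLFunctionOfNewform

end
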